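import Literature.NumberTheory.Automorphic.BianchiCuspidalEigenclassOfComparison
import Literature.NumberTheory.Automorphic.ResGLnCuspidalEigenclass
import Literature.NumberTheory.Automorphic.ClozelAlgebraicityHeckeFieldResProofs
import Literature.NumberTheory.Automorphic.ClozelCohomologicalTypeProofs
import Literature.NumberTheory.DiophantineGeometry.GLHighestWeightFacts
import HarnessLib

/-!
# `bianchi_cuspidal_regularLAlgebraic_eigenclassExists` from the cuspidal-eigenclass fact for
# `Res_{K/ℚ} GL_n` (`ResGLnCohomology.cuspidalEigenclass_exists`)

Topic `Literature/NumberTheory/Automorphic`. Proofs-only sibling (theorems, no definitions, no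
named facts) of `BianchiCuspidalEigenclass` / `BianchiCuspidalEigenclassProofs` /
`BianchiCuspidalEigenclassOfComparison`.

The named fact `bianchi_cuspidal_regularLAlgebraic_eigenclassExists` — the Hecke eigensystem of
a cuspidal regular `L`-algebraic `Π` of `GL₂` over an imaginary quadratic field occurs in the
cohomology of an `S`-good level with algebraic coefficients, in the form of
[Scholze2015, §V.4, proof of Cor. V.4.2] ("`π' = π|·|^{(n+1)/2}` is regular `C`-algebraic, i.e.
cohomological (cf. [Clozel]) … there exists some algebraic representation `ξ` of
`Res_{F/ℚ} GL_n` … such that `π'` occurs in `H^i(X̃_K, M_{ξ,K}) ⊗ ℂ`") — was reduced in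
`BianchiCuspidalEigenclassProofs` (`…_of_regularAlgebraic`, the printed twist, here
`Π ↦ Π^∨ ⊗ |det|^{1/2}`) to the Eichler–Shimura–Harder realisation of a cuspidal regular
`C`-algebraic `Π₀` at an `S`-good level.  The tree states that realisation, for every `n` and
every number field `K`, as the named fact `ResGLnCohomology.cuspidalEigenclass_exists`
(`ResGLnCuspidalEigenclass.lean`: Clozel's Lemme 3.15 / Borel's injectivity of cuspidal into
full cohomology / Franke's Thm. 18, on the receptacle
`H^q(GL_n(K)⁺, Fun(GL_n(𝔸_K^∞)/K_f(𝔫), E_λ(ℂ)))`).  THIS FILE proves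

* `bianchi_cuspidal_regularLAlgebraic_eigenclassExists_of_resGLn (h : cuspidalEigenclass_exists)
    : bianchi_cuspidal_regularLAlgebraic_eigenclassExists`
* `bianchi_cuspidal_regularLAlgebraic_eigenclassExists_of_resGLTwo (h2 : <the fact's statement for
    n = 2 and K totally complex of degree 2 only>) : bianchi_cuspidal_regularLAlgebraic_eigenclassExists`
  (the Bianchi slice actually consumed — Harder's case [Harder1987, §3]; the first theorem is the
  second applied to the fact's specialisation)

— so the discharge `…_holds` is one line once `ResGLnCohomology.cuspidalEigenclass_exists`, its
`n ≥ 2` slice (`ResGLnCohomology.cuspidalEigenclass_of_rank_two`) or its Bianchi slice is a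
theorem — from the tree's theorems:

1. the level: `Π₀` unramified outside `S` has a `K(𝔪)`-fixed form `φ ∈ W ∖ W'` for some `𝔪 ≠ 0`
   supported on `S` (`AutomorphicRepData.exists_principalCongruenceLevel_fixed_of_isUnramifiedAt`,
   `SGoodLevelEigenform.lean`), and `K_f(𝔪) = finitePrincipalCongruenceLevel` is `S`-good
   (`BianchiCuspidalEigenclassOfComparison.lean`, `UnramifiedLevelChange.lean`);
2. Clozel's Lemme 3.14 embedding by embedding
   (`InfinityType.IsRegularAlgebraic.exists_isDominant_forall_map_a_eq_cohomological`, dualised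
   with `Weight.IsDominant.dual` / `Weight.dual_dual`): dominant `λ_σ`, `σ : F →+* ℂ`, with the
   `a`-multisets of the regular `C`-algebraic infinity type;
3. the fact, giving a non-zero simultaneous `T_{w,i}`-eigenclass `x` (`w ∤ 𝔪`) in
   `H^q(GL₂(F)⁺, Fun(GL₂(𝔸_F^∞)/K_f(𝔪), E_λ(ℂ)))` with the eigenvalues
   `heckeEigenvalueOf 2 w β i = q_w^{i(2−i)/2} e_i(β)`;
4. **group change** `ResGLnCohomology.exists_levelCohomology_equiv_of_glTotPos_eq_top`:
   `GL₂(F)⁺ = GL₂(F)` for `F` with no real place (`glTotPos_eq_top`), and the isomorphism of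
   group cohomology along `GL_n(K)⁺ ≃* GL_n(K)` (Mathlib `groupCohomology.mapIso`) commutes with
   the double-coset operators (`groupCohomology.map_comp`);
5. **coefficient change** `ResGLnCohomology.exists_coeffSemimap_ringEquiv`: along
   `ι : E ≃+* ℂ` and the bijection `ε : (F →+* E) ≃ (F →+* ℂ)`, `τ ↦ ι ∘ τ`, the coefficient
   modules `E_λ(E) = ⊗_{τ : F →+* E} V_{λ_τ}(E)` and `E_{λ'}(ℂ) = ⊗_{σ : F →+* ℂ} V_{λ_{ε⁻¹σ}}(ℂ)`
   are identified `GL₂(F)`-equivariantly by mutually inverse `ι`- and `ι⁻¹`-semilinear maps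
   (`PiTensorProduct.reindex ε ∘ ⊗_τ ι̃_τ`, with `ι̃_τ` the tree's `weylSemimap` on the Weyl-module
   model of `V_μ`, `GLnCohomology.weylSemimap_coeffRepGL`), so that the tree's
   `TwistedQuotient.cohomologySemimap` (`ArithmeticQuotientCohomologySemilinear.lean`) carries
   `x` to a non-zero class `ξ ∈ H^q(GL₂(F), Fun(GL₂(𝔸_F^∞)/K_f(𝔪), E_λ(E)))` with
   `T_{w,i} ξ = ι⁻¹(t_{w,i}) ξ` (`heckeEnd_cohomologySemimap_of_eigen`,
   `cohomologySemimap_injective_of_leftInverse`) — the "transport of the printed case `E = ℂ`"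
   clause of the named fact;
6. `q_w^{1·1/2} e₁(β) = √q_w e₁(β)`, `q_w^{0} e₂(β) = e₂(β)`.

No named fact is introduced (D-0026); nothing printed is re-vendored.

## References

* P. Scholze, *On torsion in the cohomology of locally symmetric varieties*, Ann. of Math. 182
  (2015), §V.4, proof of Cor. V.4.2 (arXiv:1306.2070, p. 67) [Scholze2015].
* L. Clozel, *Motifs et formes automorphes: applications du principe de fonctorialité* (1990),
  Lemme 3.14, Lemme 3.15, §3.5 (pp. 120–123) [Clozel1990].
* A. Borel, N. Wallach, *Continuous cohomology, discrete subgroups, and representations of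
  reductive groups* (2000), VII [BorelWallach2000]; J. Franke, *Harmonic analysis in weighted
  L₂-spaces* (1998), Thm. 18 [Franke1998]; G. Harder, Invent. Math. 89 (1987) [Harder1987].
-/

noncomputable section

open scoped TensorProduct
open NumberField IsDedekindDomain CategoryTheory

namespace Literature.NumberTheory.Automorphic

namespace ResGLnCohomology

open GLnCohomology Literature.LinearAlgebra.Semilinear Literature.NumberTheory.DiophantineGeometry

/-! ### Group change: `GL_n(K)⁺ = GL_n(K)` for `K` with no real place -/

section GroupChange

variable (k : Type) [Field k] (n : ℕ) (K : Type) [Field K] [NumberField K]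

/-- **`H^q(GL_n(K)⁺, Fun(GL_n(𝔸_K^∞)/K_f(𝔫), E_λ)) ≅ H^q(GL_n(K), Fun(GL_n(𝔸_K^∞)/K_f(𝔫), E_λ))`
Hecke-equivariantly when `GL_n(K)⁺ = GL_n(K)`** (e.g. `K` totally imaginary): the isomorphism of
group cohomology along the group isomorphism `GL_n(K)⁺ ≃* GL_n(K)` with the identity on the
coefficients (Mathlib `groupCohomology.mapIso`), which commutes with every double-coset operator
`[K_f(𝔫) g K_f(𝔫)]` (both are instances of `groupCohomology.map`, `map_comp`). [folklore] -/
theorem exists_levelCohomology_equiv_of_glTotPos_eq_top (htop : glTotPos n K = ⊤)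
    (𝔫 : Ideal (𝓞 K)) (lam : (K →+* k) → Fin n → ℤ) (q : ℕ) :
    ∃ Φ : levelCohomology k n K 𝔫 lam q ≃ₗ[k]
        TwistedQuotient.cohomology (BigHeckeGLn.globalEmbedding n K) (level n K 𝔫)
          (coeffRep k n K lam) q,
      ∀ (g : BigHeckeGLn.FiniteAdelicGL n K) (x : levelCohomology k n K 𝔫 lam q),
        Φ (heckeOp k n K 𝔫 lam q g x) =
          TwistedQuotient.heckeEnd (BigHeckeGLn.globalEmbedding n K) (level n K 𝔫)
            (coeffRep k n K lam) g q (Φ x) := by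
  -- the group isomorphism `GL_n(K)⁺ ≃* GL_n(K)`
  let e : glTotPos n K ≃* GL (Fin n) K := (MulEquiv.subgroupCongr htop).trans Subgroup.topEquiv
  let B : Rep k (glTotPos n K) :=
    TwistedQuotient.coeffRep (diagPos n K) (level n K 𝔫) (coeffRepPos k n K lam)
  let A : Rep k (GL (Fin n) K) :=
    TwistedQuotient.coeffRep (BigHeckeGLn.globalEmbedding n K) (level n K 𝔫) (coeffRep k n K lam)
  have he : ∀ γ : glTotPos n K,
      (LinearEquiv.refl k B.V : B.V ≃ₗ[k] A.V) ∘ₗ B.ρ γ =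
        A.ρ (e γ) ∘ₗ (LinearEquiv.refl k B.V : B.V ≃ₗ[k] A.V) := fun γ =>
    LinearMap.ext fun f => rfl
  let I := groupCohomology.mapIso (A := A) (B := B) e (LinearEquiv.refl k B.V) he q
  refine ⟨I.toLinearEquiv, fun g x => ?_⟩
  -- Hecke equivariance: both composites are `groupCohomology.map e.symm (T_g-then-id)`
  have hsq : I.hom ≫ TwistedQuotient.heckeOperator (BigHeckeGLn.globalEmbedding n K) (level n K 𝔫)
        (coeffRep k n K lam) g q =
      TwistedQuotient.heckeOperator (diagPos n K) (level n K 𝔫) (coeffRepPos k n K lam) g q ≫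
        I.hom := by
    simp only [I, groupCohomology.mapIso_hom, TwistedQuotient.heckeOperator]
    rw [← groupCohomology.map_comp, ← groupCohomology.map_comp]
    exact groupCohomology.map_congr (by ext; rfl) (LinearMap.ext fun f => rfl) q
  have h := LinearMap.congr_fun (congrArg ModuleCat.Hom.hom hsq) x
  rw [ModuleCat.hom_comp, ModuleCat.hom_comp, LinearMap.comp_apply, LinearMap.comp_apply] at h
  exact h.symm

end GroupChange

/-! ### Coefficient change along a ring isomorphism `e : k ≃+* k'` -/

section CoeffChange

variable {k k' : Type} [Field k] [Field k'] (e : k ≃+* k') (n : ℕ) (K : Type) [Field K]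

/-- **`E_λ` over isomorphic coefficient fields.**  For a ring isomorphism `e : k ≃+* k'`, the
bijection `ε : (K →+* k) ≃ (K →+* k')`, `τ ↦ e ∘ τ`, of embeddings and weights
`λ = (λ_τ)_{τ : K →+* k}`, put `λ'_σ := λ_{ε⁻¹ σ}` (`σ : K →+* k'`).  Then there are an
`e`-semilinear `s : E_λ(k) → E_{λ'}(k')` and an `e⁻¹`-semilinear `s' : E_{λ'}(k') → E_λ(k)`,
inverse to each other and both `GL_n(K)`-equivariant: `s = (reindex ε) ∘ ⊗_τ ẽ_τ` with
`ẽ_τ : V_{λ_τ}(k) → V_{λ_τ}(k')` the coordinatewise action of `e` on the Weyl module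
(`weylSemimap`, `weylSemimap_coeffRepGL`: `ẽ (V_μ(g) w) = V_μ(e g) (ẽ w)`, and
`e (τ g) = (ε τ) g`).  (Transport of structure: the algebraic representation `E_λ` is defined over
`ℤ`, so its `k`- and `k'`-points are identified along any `k ≅ k'`.) [folklore] -/
theorem exists_coeffSemimap_ringEquiv (ε : (K →+* k) ≃ (K →+* k'))
    (hε : ∀ τ : K →+* k, (ε τ : K →+* k') = (e : k →+* k').comp τ)
    (wt : (K →+* k) → Fin n → ℤ) :
    ∃ (s : CoeffModule k n K wt →ₛₗ[(e : k →+* k')] CoeffModule k' n K (fun σ => wt (ε.symm σ)))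
      (s' : CoeffModule k' n K (fun σ => wt (ε.symm σ)) →ₛₗ[(e.symm : k' →+* k)]
        CoeffModule k n K wt),
      (∀ (g : GL (Fin n) K) (v : CoeffModule k n K wt),
          s (coeffRep k n K wt g v) = coeffRep k' n K (fun σ => wt (ε.symm σ)) g (s v)) ∧
      (∀ (g : GL (Fin n) K) (u : CoeffModule k' n K (fun σ => wt (ε.symm σ))),
          s' (coeffRep k' n K (fun σ => wt (ε.symm σ)) g u) = coeffRep k n K wt g (s' u)) ∧
      (∀ v, s' (s v) = v) ∧ (∀ u, s (s' u) = u) := by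
  have hε' : ∀ σ : K →+* k', (e : k →+* k').comp (ε.symm σ) = σ := fun σ => by
    rw [← hε, Equiv.apply_symm_apply]
  -- the factors over `k'`, indexed by the embeddings into `k`
  let W : (K →+* k) → Type := fun τ => GLnCohomology.CoeffModule k' n (wt τ)
  -- factorwise semilinear maps `ẽ_τ`, `ẽ⁻¹_τ`
  let f : ∀ τ : K →+* k,
      GLnCohomology.CoeffModule k n (wt τ) →ₛₗ[(e : k →+* k')] GLnCohomology.CoeffModule k' n (wt τ) :=
    fun τ => (weylSemimap (e : k →+* k') (Fin n) (coeffPartition (wt τ)) :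
      GLnCohomology.CoeffModule k n (wt τ) →ₛₗ[(e : k →+* k')] GLnCohomology.CoeffModule k' n (wt τ))
  let f' : ∀ τ : K →+* k,
      GLnCohomology.CoeffModule k' n (wt τ) →ₛₗ[(e.symm : k' →+* k)]
        GLnCohomology.CoeffModule k n (wt τ) :=
    fun τ => (weylSemimap (e.symm : k' →+* k) (Fin n) (coeffPartition (wt τ)) :
      GLnCohomology.CoeffModule k' n (wt τ) →ₛₗ[(e.symm : k' →+* k)]
        GLnCohomology.CoeffModule k n (wt τ))
  have hff' : ∀ τ (v : GLnCohomology.CoeffModule k n (wt τ)), f' τ (f τ v) = v := fun τ v =>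
    weylSemimap_weylSemimap_coeffModule _ _ (fun c => e.symm_apply_apply c) n (wt τ) v
  have hf'f : ∀ τ (w : GLnCohomology.CoeffModule k' n (wt τ)), f τ (f' τ w) = w := fun τ w =>
    weylSemimap_weylSemimap_coeffModule _ _ (fun c => e.apply_symm_apply c) n (wt τ) w
  have hf : ∀ τ (g : GL (Fin n) K) (w : GLnCohomology.CoeffModule k n (wt τ)),
      f τ (coeffRepGL k n (wt τ) (Matrix.GeneralLinearGroup.map (τ : K →+* k) g) w) =
        coeffRepGL k' n (wt τ) (Matrix.GeneralLinearGroup.map (ε τ : K →+* k') g) (f τ w) :=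
    fun τ g w => by
      rw [hε τ, Matrix.GeneralLinearGroup.map_comp]
      exact weylSemimap_coeffRepGL (e : k →+* k') n (wt τ) _ w
  have hf' : ∀ τ (g : GL (Fin n) K) (w : GLnCohomology.CoeffModule k' n (wt τ)),
      f' τ (coeffRepGL k' n (wt τ) (Matrix.GeneralLinearGroup.map (ε τ : K →+* k') g) w) =
        coeffRepGL k n (wt τ) (Matrix.GeneralLinearGroup.map (τ : K →+* k) g) (f' τ w) :=
    fun τ g w => by
      have hg : Matrix.GeneralLinearGroup.map (τ : K →+* k) g =
          Matrix.GeneralLinearGroup.map (e.symm : k' →+* k)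
            (Matrix.GeneralLinearGroup.map (ε τ : K →+* k') g) := by
        ext i j
        simp [hε τ]
      rw [hg]
      exact weylSemimap_coeffRepGL (e.symm : k' →+* k) n (wt τ) _ w
  refine ⟨(PiTensorProduct.reindex k' W ε).toLinearMap.comp (PiTensorProduct.semimap f),
    (PiTensorProduct.semimap f').comp (PiTensorProduct.reindex k' W ε).symm.toLinearMap,
    fun g v => ?_, fun g u => ?_, fun v => ?_, fun u => ?_⟩
  · -- `s (g • v) = g • s v` (computed on `PiTensorProduct.map`, `coeffRep_apply`)
    change PiTensorProduct.reindex k' W ε (PiTensorProduct.semimap f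
        (PiTensorProduct.map (R := k)
          (fun τ => (coeffRepGL k n (wt τ) (Matrix.GeneralLinearGroup.map (τ : K →+* k) g) :
            GLnCohomology.CoeffModule k n (wt τ) →ₗ[k] GLnCohomology.CoeffModule k n (wt τ))) v)) =
      PiTensorProduct.map (R := k')
        (fun σ => (coeffRepGL k' n (wt (ε.symm σ)) (Matrix.GeneralLinearGroup.map (σ : K →+* k') g) :
          W (ε.symm σ) →ₗ[k'] W (ε.symm σ)))
        (PiTensorProduct.reindex k' W ε (PiTensorProduct.semimap f v))
    have hfam : (fun σ => (coeffRepGL k' n (wt (ε.symm σ))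
          (Matrix.GeneralLinearGroup.map (σ : K →+* k') g) : W (ε.symm σ) →ₗ[k'] W (ε.symm σ))) =
        fun σ => (coeffRepGL k' n (wt (ε.symm σ))
          (Matrix.GeneralLinearGroup.map (ε (ε.symm σ) : K →+* k') g) :
            W (ε.symm σ) →ₗ[k'] W (ε.symm σ)) := by
      funext σ
      rw [Equiv.apply_symm_apply]
    rw [PiTensorProduct.semimap_map f f _
        (fun τ => (coeffRepGL k' n (wt τ) (Matrix.GeneralLinearGroup.map (ε τ : K →+* k') g) :
          W τ →ₗ[k'] W τ)) (fun τ w => hf τ g w) v, hfam,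
      ← PiTensorProduct.map_reindex
        (fun τ => (coeffRepGL k' n (wt τ) (Matrix.GeneralLinearGroup.map (ε τ : K →+* k') g) :
          W τ →ₗ[k'] W τ)) ε]
  · -- `s' (g • u) = g • s' u`
    change PiTensorProduct.semimap f' ((PiTensorProduct.reindex k' W ε).symm
        (PiTensorProduct.map (R := k')
          (fun σ => (coeffRepGL k' n (wt (ε.symm σ))
            (Matrix.GeneralLinearGroup.map (σ : K →+* k') g) : W (ε.symm σ) →ₗ[k'] W (ε.symm σ)))
          u)) =
      PiTensorProduct.map (R := k)
        (fun τ => (coeffRepGL k n (wt τ) (Matrix.GeneralLinearGroup.map (τ : K →+* k) g) :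
          GLnCohomology.CoeffModule k n (wt τ) →ₗ[k] GLnCohomology.CoeffModule k n (wt τ)))
        (PiTensorProduct.semimap f' ((PiTensorProduct.reindex k' W ε).symm u))
    have hfam : (fun σ => (coeffRepGL k' n (wt (ε.symm σ))
          (Matrix.GeneralLinearGroup.map (σ : K →+* k') g) : W (ε.symm σ) →ₗ[k'] W (ε.symm σ))) =
        fun σ => (coeffRepGL k' n (wt (ε.symm σ))
          (Matrix.GeneralLinearGroup.map (ε (ε.symm σ) : K →+* k') g) :
            W (ε.symm σ) →ₗ[k'] W (ε.symm σ)) := by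
      funext σ
      rw [Equiv.apply_symm_apply]
    rw [hfam, ← PiTensorProduct.map_reindex_symm
      (fun τ => (coeffRepGL k' n (wt τ) (Matrix.GeneralLinearGroup.map (ε τ : K →+* k') g) :
        W τ →ₗ[k'] W τ)) ε u]
    exact PiTensorProduct.semimap_map f' f' _ _ (fun τ w => hf' τ g w) _
  · -- `s' (s v) = v`
    change PiTensorProduct.semimap f' ((PiTensorProduct.reindex k' W ε).symm
      (PiTensorProduct.reindex k' W ε (PiTensorProduct.semimap f v))) = v
    rw [LinearEquiv.symm_apply_apply]
    exact PiTensorProduct.semimap_semimap_of_leftInverse f f' (fun c => e.symm_apply_apply c) hff' v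
  · -- `s (s' u) = u`
    change PiTensorProduct.reindex k' W ε (PiTensorProduct.semimap f
      (PiTensorProduct.semimap f' ((PiTensorProduct.reindex k' W ε).symm u))) = u
    rw [PiTensorProduct.semimap_semimap_of_leftInverse f' f (fun c => e.apply_symm_apply c) hf'f]
    exact LinearEquiv.apply_symm_apply _ u

end CoeffChange

end ResGLnCohomology

/-! ### The reduction -/

open scoped Classical in
open ResGLnCohomology Literature.NumberTheory.DiophantineGeometry Literature.Barriers.Langlands in
/-- **`bianchi_cuspidal_regularLAlgebraic_eigenclassExists` from the BIANCHI SLICE of the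
cuspidal-eigenclass statement** — the statement of `ResGLnCohomology.cuspidalEigenclass_exists`
(Clozel's Lemme 3.15 / Borel / Franke) restricted to exactly what the named fact consumes:
`n = 2` and `K` totally complex of degree `2` (imaginary quadratic), i.e. the Eichler–Shimura–Harder
realisation of cuspidal cohomological representations of `GL₂` over an imaginary quadratic field
in `H^q(GL₂(K)⁺, Fun(GL₂(𝔸_K^∞)/K_f(𝔫), E_λ(ℂ)))` [Harder1987, §3].  The hypothesis `h2` is that
slice written out (binders verbatim from the fact, specialised); it is implied by the fact
(`bianchi_cuspidal_regularLAlgebraic_eigenclassExists_of_resGLn` below), by its `n ≥ 2` slice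
(`ResGLnCohomology.cuspidalEigenclass_of_rank_two`), and by any Bianchi-only realisation theorem,
so the discharge `…_holds` is one line from whichever lands first.  Scholze's printed argument
[Scholze2015, §V.4, proof of Cor. V.4.2]: a `C`-algebraic twist `π'` of the regular `L`-algebraic
cuspidal `π` is regular `C`-algebraic, i.e. cohomological [Clozel1990, Lemme 3.14], hence "occurs
in `H^i(X̃_K, M_{ξ,K}) ⊗ ℂ` for some sufficiently small level `K = K_S K^S`".  Formally: the twist
`Π ↦ Π^∨ ⊗ |det|^{1/2}` and the eigenvalue dictionary are
`bianchi_cuspidal_regularLAlgebraic_eigenclassExists_of_regularAlgebraic`; the level `K(𝔪)`,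
`𝔪 ≠ 0` supported on `S`, with a fixed form off `W'` is
`AutomorphicRepData.exists_principalCongruenceLevel_fixed_of_isUnramifiedAt`, and `K_f(𝔪)` is
`S`-good; Lemme 3.14 per embedding is
`InfinityType.IsRegularAlgebraic.exists_isDominant_forall_map_a_eq_cohomological` (dualised);
`h2` gives the eigenclass over `ℂ` on `GL₂(F)⁺`; it is carried to `GL₂(F)`
(`exists_levelCohomology_equiv_of_glTotPos_eq_top`, `F` has no real place) and to coefficients in
`E ≅ ℂ` (`exists_coeffSemimap_ringEquiv` with `TwistedQuotient.cohomologySemimap`), the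
eigenvalues `q_w^{i(2−i)/2} e_i(β)` becoming `ι⁻¹(√q_w e₁(β))`, `ι⁻¹(e₂(β))`.
[cite: Scholze2015, §V.4, proof of Cor. V.4.2] [cite: Clozel1990, Lemme 3.14–3.15 and §3.5]
[cite: Harder1987, §3] -/
theorem bianchi_cuspidal_regularLAlgebraic_eigenclassExists_of_resGLTwo
    (h2 : ∀ (K : Type) [Field K] [NumberField K], NumberField.IsTotallyComplex K →
      Module.finrank ℚ K = 2 → ∀ (hcpt : isCompact_glFiniteIntegralLevel 2 K)
      (𝔫 : Ideal (𝓞 K)) (lam : (K →+* ℂ) → Fin 2 → ℤ), 𝔫 ≠ 0 →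
      (∀ τ, Weight.IsDominant (lam τ)) →
      ∀ π : CuspidalAutomorphicRepData 2 K hcpt,
        (∃ T : InfinityType K 2, π.1.HasInfinityType T ∧
          ∀ τ : K →+* ℂ, (T τ).map ArchWeight.a =
            (cohomologicalInfinityType 2 K (Weight.dual (lam τ)) τ).map ArchWeight.a) →
        (∃ φ ∈ π.1.W, φ ∉ π.1.W' ∧
          ∀ u ∈ principalCongruenceLevel 2 K 𝔫, rightTranslation (AdelicGroupData.gl 2 K) u φ = φ) →
        ∃ (q : ℕ) (x : ResGLnCohomology.levelCohomology ℂ 2 K 𝔫 lam q), x ≠ 0 ∧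
          ∀ v : HeightOneSpectrum (𝓞 K), ¬ v.asIdeal ∣ 𝔫 → ∀ α : Multiset ℂ,
            π.1.HasSatakeParamAt v α → ∀ i ≤ 2,
              ResGLnCohomology.heckeT ℂ 2 K 𝔫 lam q v i x = heckeEigenvalueOf 2 v α i • x) :
    bianchi_cuspidal_regularLAlgebraic_eigenclassExists := by
  refine bianchi_cuspidal_regularLAlgebraic_eigenclassExists_of_regularAlgebraic ?_
  intro F _ _ htc hdeg hcpt E _ ι π T hT hTra S hS hunr
  -- (1) the level `K(𝔪)`, `𝔪 ≠ 0` supported on `S`, with a `K(𝔪)`-fixed form off `W'`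
  obtain ⟨𝔪, h𝔪, h𝔪S, φ, hφW, hφW', hfix⟩ :=
    π.1.exists_principalCongruenceLevel_fixed_of_isUnramifiedAt S hunr
  have hw𝔪 : ∀ w ∉ S, ¬ w.asIdeal ∣ 𝔪 := fun w hw hd => hw (h𝔪S w hd)
  -- (2) Clozel's Lemme 3.14 embedding by embedding: dominant `wtC σ` with the `a`-multisets of `T`
  obtain ⟨wtC, hdomC, haC⟩ :=
    InfinityType.IsRegularAlgebraic.exists_isDominant_forall_map_a_eq_cohomological hT.1.1 hTra
  -- the bijection of embeddings `ε : (F →+* E) ≃ (F →+* ℂ)`, `τ ↦ ι ∘ τ`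
  let ε : (F →+* E) ≃ (F →+* ℂ) :=
    { toFun := fun τ => (ι : E →+* ℂ).comp τ
      invFun := fun σ => (ι.symm : ℂ →+* E).comp σ
      left_inv := fun τ => RingHom.ext fun x => ι.symm_apply_apply (τ x)
      right_inv := fun σ => RingHom.ext fun x => ι.apply_symm_apply (σ x) }
  have hε : ∀ τ : F →+* E, (ε τ : F →+* ℂ) = (ι : E →+* ℂ).comp τ := fun _ => rfl
  -- the weights: `wt τ := (wtC (ι ∘ τ))^∨` on the embeddings into `E`; the fact is applied with
  -- `λ_σ := wt (ε⁻¹ σ) = (wtC σ)^∨`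
  let wt : (F →+* E) → Fin 2 → ℤ := fun τ => Weight.dual (wtC (ε τ))
  have hlam : ∀ σ : F →+* ℂ, wt (ε.symm σ) = Weight.dual (wtC σ) := fun σ => by
    simp only [wt, Equiv.apply_symm_apply]
  have hdom : ∀ σ : F →+* ℂ, Weight.IsDominant (wt (ε.symm σ)) := fun σ => by
    rw [hlam]
    exact (hdomC σ).dual
  have ha : ∀ σ : F →+* ℂ, (T σ).map ArchWeight.a =
      (cohomologicalInfinityType 2 F (Weight.dual (wt (ε.symm σ))) σ).map ArchWeight.a :=
    fun σ => by
      rw [hlam, Weight.dual_dual]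
      exact haC σ
  -- (3) the cuspidal eigenclass over `ℂ` on `GL₂(F)⁺`
  obtain ⟨q, x, hx, heig⟩ := h2 F htc hdeg hcpt 𝔪 (fun σ => wt (ε.symm σ)) h𝔪 hdom π
    ⟨T, hT, ha⟩ ⟨φ, hφW, hφW', hfix⟩
  -- (4) group change `GL₂(F)⁺ = GL₂(F)` (`F` has no real place)
  haveI : NumberField.IsTotallyComplex F := htc
  haveI : IsEmpty (F →+* ℝ) := ⟨fun τ =>
    NumberField.IsTotallyComplex.complexEmbedding_not_isReal (K := F) (Complex.ofRealHom.comp τ)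
      (by
        rw [NumberField.ComplexEmbedding.isReal_iff]
        ext y
        simp)⟩
  obtain ⟨Φ, hΦ⟩ := exists_levelCohomology_equiv_of_glTotPos_eq_top ℂ 2 F glTotPos_eq_top 𝔪
    (fun σ => wt (ε.symm σ)) q
  -- (5) coefficient change `ℂ → E` along `ι⁻¹`
  obtain ⟨s, s', hs, hs', -, hs's⟩ := exists_coeffSemimap_ringEquiv ι 2 F ε hε wt
  have hΨinj := TwistedQuotient.cohomologySemimap_injective_of_leftInverse
    (BigHeckeGLn.globalEmbedding 2 F) (level 2 F 𝔪) (coeffRep ℂ 2 F fun σ => wt (ε.symm σ))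
    (coeffRep E 2 F wt) s' hs' s hs hs's q
  -- the `S`-good level `K_f(𝔪)` and the weights `wt`
  refine ⟨level 2 F 𝔪,
    isOpen_comap_ofFinite_principalCongruenceLevel 2 F h𝔪,
    isCompact_comap_ofFinite_principalCongruenceLevel 2 F h𝔪,
    comap_ofFinite_principalCongruenceLevel_le 2 F 𝔪,
    fun w hw g hg =>
      (BigHeckeGLn.isUnramifiedLevel_comap_principalCongruenceLevel h𝔪 (hw𝔪 w hw)).map_mem hg,
    fun w _ u hu =>
      BigHeckeGLn.mul_ofLocal_localComponent_inv_mem_comap_principalCongruenceLevel w hu,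
    wt, fun τ => (hdomC (ε τ)).dual, fun ρ hρeq => ?_⟩
  subst hρeq
  -- the transported class `ξ := H^q(s') (Φ x)`
  refine ⟨q, TwistedQuotient.cohomologySemimap (BigHeckeGLn.globalEmbedding 2 F) (level 2 F 𝔪)
      (coeffRep ℂ 2 F fun σ => wt (ε.symm σ)) (coeffRep E 2 F wt) s' hs' q (Φ x), ?_,
    fun w hw β hβ => ?_⟩
  · -- non-zero: `H^q(s')` and `Φ` are injective
    intro h0
    have h1 : Φ x = 0 := hΨinj (h0.trans (map_zero _).symm)
    exact hx ((LinearEquiv.map_eq_zero_iff Φ).mp h1)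
  · -- the eigenvalues: `T_{w,i} x = t_{w,i} x` is carried to `T_{w,i} ξ = ι⁻¹(t_{w,i}) ξ`
    have key : ∀ (i : ℕ), i ≤ 2 →
        TwistedQuotient.heckeEnd (BigHeckeGLn.globalEmbedding 2 F) (level 2 F 𝔪)
            (coeffRep E 2 F wt) (BigHeckeGLn.heckeElement 2 F w i) q
            (TwistedQuotient.cohomologySemimap (BigHeckeGLn.globalEmbedding 2 F) (level 2 F 𝔪)
              (coeffRep ℂ 2 F fun σ => wt (ε.symm σ)) (coeffRep E 2 F wt) s' hs' q (Φ x)) =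
          (ι.symm : ℂ →+* E) (heckeEigenvalueOf 2 w β i) •
            TwistedQuotient.cohomologySemimap (BigHeckeGLn.globalEmbedding 2 F) (level 2 F 𝔪)
              (coeffRep ℂ 2 F fun σ => wt (ε.symm σ)) (coeffRep E 2 F wt) s' hs' q (Φ x) := by
      intro i hi
      refine TwistedQuotient.heckeEnd_cohomologySemimap_of_eigen _ _ _ _ s' hs' _ q ?_
      have hx' := congrArg Φ (heig w (hw𝔪 w hw) β hβ i hi)
      rw [hΦ, map_smul] at hx'
      exact hx'
    have k1 := key 1 (by norm_num)
    have k2 := key 2 le_rfl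
    simp only [heckeEigenvalueOf, show (1 * (2 - 1) : ℕ) = 1 from rfl, pow_one,
      show (2 * (2 - 2) : ℕ) = 0 from rfl, pow_zero, one_mul, RingEquiv.coe_toRingHom] at k1 k2
    exact ⟨k1, k2⟩

/-- **`bianchi_cuspidal_regularLAlgebraic_eigenclassExists` from the cuspidal-eigenclass fact for
`Res_{K/ℚ} GL_n`** (`ResGLnCohomology.cuspidalEigenclass_exists`: Clozel's Lemme 3.15 / Borel /
Franke, any `n`, any number field): the fact implies its Bianchi slice, and
`bianchi_cuspidal_regularLAlgebraic_eigenclassExists_of_resGLTwo` does the rest, so the discharge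
`…_holds` is one line once `ResGLnCohomology.cuspidalEigenclass_exists` is a theorem.
[cite: Scholze2015, §V.4, proof of Cor. V.4.2] [cite: Clozel1990, Lemme 3.14–3.15 and §3.5] -/
theorem bianchi_cuspidal_regularLAlgebraic_eigenclassExists_of_resGLn
    (h : ResGLnCohomology.cuspidalEigenclass_exists) :
    bianchi_cuspidal_regularLAlgebraic_eigenclassExists :=
  bianchi_cuspidal_regularLAlgebraic_eigenclassExists_of_resGLTwo
    fun K _ _ _ _ hcpt 𝔫 lam h𝔫 => h 2 K hcpt 𝔫 lam (by norm_num) h𝔫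

end Literature.NumberTheory.Automorphic

end
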